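/-
Origin: expansion seat `planner-pub-hodgecm-pv14-g3-0`, handover #7 v2 2026-08-18T07:02:52Z staged-variant (`HOME/pub-hodgecm-pv14-g3/lean/Pv14g3/Staged/P43_KTypesJplusGrading.lean`, md5 254d9930, 308 lines);
landed by the gen-7 packager in gate run 25 as `HodgeCM/PerL34/P43_KTypesJplusGrading.lean` (verbatim).
-/
/-
Origin: HOME/pub-hodgecm-pv14-g3/lean/Pv14g3/PerL34/P43KTypesJplusGrading.lean — session planner-pub-hodgecm-pv14-g3-0
(unit pub-hodgecm-pv14-g3, DAG-NODE PROVER #14 gen 3).  Intended final place: `HodgeCM/PerL34/P43_KTypesJplusGrading.lean`,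
after `P43_KTypesFockJplus.lean` (this seat, run 23).  On landing rewrite the import
`Pv14g3.PerL34.P43KTypesFockJplus` ↦ `HodgeCM.PerL34.P43_KTypesFockJplus`.  DAG node **N33b** (tex ll. 646–648:
"the lowest `K_{ι₁}`-type of `J⁺` is `𝔭₊ ⊠ 𝟏`").  Nothing cited, nothing asserted.
-/
import Summits.HodgeConjecture.HodgeCM.PerL34.P43_KTypesFockJplus

set_option autoImplicit false

/-!
# N33b (X1), concrete `K_{ι₁}`-types VII: the `K`-stable grading of `J⁺|_K` and its lowest piece `𝔭₊` — GROUP level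

pv12's `FockKTypes.jplus_lowest` types PerL's sentence "the lowest `K_{ι₁}`-type of `J⁺` is `𝔭₊`" (ll. 646–648)
INFINITESIMALLY (torus weights).  Here it is a theorem about the GROUP `K = U(2) × U(1)` acting on the `J⁺`-piece
`jplusSubmodule ⊂ ℂ[z₁,z₂,w]` (`P43_KTypesFockJplus.Jplus`):

* `jplusDeg n := J⁺ ∩ {z-degree n}` (`n ≥ 0`; its monomials are `z^a w^{n-1}`, `|a| = n`) is `K`-STABLE
  (`fockRep_mem_jplusDeg`), the centre `U(1)_{ι₁} = {(1,d)}` acts on it by the scalar `d̄ⁿ`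
  (**`fockRep_central_of_mem_jplusDeg`**), `jplusDeg 0 = ⊥` (**`jplusDeg_zero`**) and the pieces exhaust `J⁺`
  (**`iSup_jplusDeg : ⨆ n, jplusDeg n = jplusSubmodule`**) — so the `U(1)_{ι₁}`-characters of `J⁺|_K` are exactly
  the `d̄ⁿ`, `n ≥ 1`;
* the LOWEST piece is the abstract `𝔭₊`: **`jplusDeg_one_eq_range_zLin : jplusDeg 1 = range zLin`** (`= ℂz₁ ⊕ ℂz₂`,
  the image of the injective `K`-intertwiner `zEmb : pPlus → Jplus` of `P43_KTypesFockJplus`).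
-/

noncomputable section

namespace HodgeCM
namespace PerL34
namespace P43KTypesU2

open MvPolynomial

/-! ## The `z`-degree grading -/

/-- The `z`-degree weight: `z_a ↦ 1`, `w ↦ 0`. -/
def zWt : Fock.HarmVar → ℕ
  | Sum.inl _ => 1
  | Sum.inr _ => 0

/-- (Ported verbatim from the HodgeCMPerL package; no docstring in the source.) -/
theorem weight_zWt_eq (m : Fock.HarmVar →₀ ℕ) : Finsupp.weight zWt m = m (Sum.inl 0) + m (Sum.inl 1) := by
  rw [Finsupp.weight_apply, Finsupp.sum_fintype _ _ (fun _ => by simp)]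
  simp only [zWt, Fintype.sum_sum_type, Fin.sum_univ_two, Fintype.sum_unique, smul_eq_mul, mul_one, mul_zero,
    add_zero]

/-- The `n`-th graded piece of `J⁺|_K`: `J⁺ ∩ {z-degree n}`. -/
def jplusDeg (n : ℕ) : Submodule ℂ Fock.HarmModel :=
  jplusSubmodule ⊓ weightedHomogeneousSubmodule ℂ zWt n

/-- (Ported verbatim from the HodgeCMPerL package; no docstring in the source.) -/
theorem jplusDeg_le (n : ℕ) : jplusDeg n ≤ jplusSubmodule := inf_le_left

/-- (Ported verbatim from the HodgeCMPerL package; no docstring in the source.) -/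
theorem mem_jplusDeg {n : ℕ} {f : Fock.HarmModel} :
    f ∈ jplusDeg n ↔ Fock.InJplus f ∧ IsWeightedHomogeneous zWt f n := by
  rw [jplusDeg, Submodule.mem_inf, mem_jplusSubmodule, mem_weightedHomogeneousSubmodule]

/-- Support description: `f ∈ jplusDeg n` iff every monomial `z^a w^e` of `f` has `|a| = n` and `e + 1 = n`. -/
theorem mem_jplusDeg_iff_support {n : ℕ} {f : Fock.HarmModel} :
    f ∈ jplusDeg n ↔ ∀ m ∈ f.support, m (Sum.inl 0) + m (Sum.inl 1) = n ∧ m (Sum.inr ()) + 1 = n := by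
  rw [mem_jplusDeg, inJplus_iff_support]
  refine ⟨fun ⟨h1, h2⟩ m hm => ?_, fun h => ⟨fun m hm => ?_, fun d hd => ?_⟩⟩
  · have a := h1 m hm
    have b : Finsupp.weight zWt m = n := h2 (mem_support_iff.mp hm)
    rw [weight_zWt_eq] at b
    omega
  · have := h m hm
    omega
  · have := h d (mem_support_iff.mpr hd)
    rw [weight_zWt_eq]
    omega

/-- There is no piece of `z`-degree `0` (`e + 1 = 0` is impossible): `J⁺` contains no constants and no `w^e`. -/
theorem jplusDeg_zero : jplusDeg 0 = ⊥ := by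
  rw [eq_bot_iff]
  intro f hf
  rw [mem_jplusDeg_iff_support] at hf
  rw [Submodule.mem_bot, ← support_eq_empty, Finset.eq_empty_iff_forall_notMem]
  intro m hm
  have := (hf m hm).2
  omega

/-! ## `K`-stability of the pieces -/

/-- (Ported verbatim from the HodgeCMPerL package; no docstring in the source.) -/
theorem isWeightedHomogeneous_zWt_substVar (k : K) (v : Fock.HarmVar) :
    IsWeightedHomogeneous zWt (substVar k v) (zWt v) := by
  cases v with
  | inl a =>
    show IsWeightedHomogeneous zWt (∑ b : Fin 2, (mat k) b a • X (Sum.inl b)) (zWt (Sum.inl a))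
    refine IsWeightedHomogeneous.sum _ _ _ (fun b _ => ?_)
    rw [smul_eq_C_mul]
    exact (isWeightedHomogeneous_X ℂ zWt (Sum.inl b)).C_mul _
  | inr u =>
    show IsWeightedHomogeneous zWt (star (k.2 : ℂ) • X (Sum.inr u)) (zWt (Sum.inr u))
    rw [smul_eq_C_mul]
    exact (isWeightedHomogeneous_X ℂ zWt (Sum.inr u)).C_mul _

/-- (Ported verbatim from the HodgeCMPerL package; no docstring in the source.) -/
theorem isWeightedHomogeneous_zWt_substHom (k : K) {f : Fock.HarmModel} {n : ℕ}
    (hf : IsWeightedHomogeneous zWt f n) : IsWeightedHomogeneous zWt (substHom k f) n := by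
  rw [f.as_sum, map_sum]
  refine IsWeightedHomogeneous.sum _ _ _ (fun d hd => ?_)
  have hn : Finsupp.weight zWt d = n := hf (mem_support_iff.mp hd)
  rw [substHom, aeval_monomial, ← hn, MvPolynomial.algebraMap_eq, Finsupp.weight_apply, Finsupp.sum,
    Finsupp.prod]
  refine IsWeightedHomogeneous.C_mul ?_ _
  refine IsWeightedHomogeneous.prod _ _ _ (fun v _ => ?_)
  exact (isWeightedHomogeneous_zWt_substVar k v).pow (d v)

/-- **Each graded piece `jplusDeg n` is `K`-stable.** -/
theorem fockRep_mem_jplusDeg (k : K) {n : ℕ} {f : Fock.HarmModel} (hf : f ∈ jplusDeg n) :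
    fockRep k f ∈ jplusDeg n := by
  rw [mem_jplusDeg] at hf ⊢
  refine ⟨inJplus_fockRep k hf.1, ?_⟩
  rw [fockRep_apply, smul_eq_C_mul]
  exact (isWeightedHomogeneous_zWt_substHom k hf.2).C_mul _

/-! ## The centre `U(1)_{ι₁}` acts on the `n`-th piece by `d̄ⁿ` -/

/-- **On `jplusDeg n` the central `U(1)`-factor `(1,d)` acts by the scalar `d̄ⁿ`** (`z^a w^{n-1} ↦ d̄ · d̄^{n-1} z^a w^{n-1}`). -/
theorem fockRep_central_of_mem_jplusDeg (d : unitary ℂ) {n : ℕ} {f : Fock.HarmModel} (hf : f ∈ jplusDeg n) :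
    fockRep (diagK 1 1 d) f = (star (d : ℂ)) ^ n • f := by
  rw [mem_jplusDeg_iff_support] at hf
  rw [f.as_sum, map_sum, Finset.smul_sum]
  refine Finset.sum_congr rfl (fun m hm => ?_)
  obtain ⟨-, h2⟩ := hf m hm
  rw [fockRep_diagK_monomial, ← h2, pow_succ']
  simp

/-! ## The pieces exhaust `J⁺`; the lowest one is `𝔭₊` -/

/-- The `z`-degree-`n` component of an element of `J⁺` lies in `jplusDeg n`. -/
theorem weightedHomogeneousComponent_mem_jplusDeg {f : Fock.HarmModel} (hf : f ∈ jplusSubmodule) (n : ℕ) :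
    weightedHomogeneousComponent zWt n f ∈ jplusDeg n := by
  classical
  rw [mem_jplusSubmodule, inJplus_iff_isWeightedHomogeneous] at hf
  rw [mem_jplusDeg, inJplus_iff_isWeightedHomogeneous]
  refine ⟨fun d hd => hf ?_, weightedHomogeneousComponent_isWeightedHomogeneous n f⟩
  rw [coeff_weightedHomogeneousComponent] at hd
  by_cases h : Finsupp.weight zWt d = n
  · rwa [if_pos h] at hd
  · rw [if_neg h] at hd
    exact absurd rfl hd

/-- **`J⁺ = ⨆ₙ jplusDeg n`** (with `jplusDeg 0 = ⊥`: the `U(1)_{ι₁}`-characters of `J⁺|_K` are the `d̄ⁿ`, `n ≥ 1`). -/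
theorem iSup_jplusDeg : (⨆ n : ℕ, jplusDeg n) = jplusSubmodule := by
  refine le_antisymm (iSup_le jplusDeg_le) (fun f hf => ?_)
  rw [← sum_weightedHomogeneousComponent zWt f]
  exact finsum_induction (fun g => g ∈ ⨆ n, jplusDeg n) (Submodule.zero_mem _)
    (fun x y hx hy => Submodule.add_mem _ hx hy)
    (fun n => Submodule.mem_iSup_of_mem n (weightedHomogeneousComponent_mem_jplusDeg hf n))

/-- (Ported verbatim from the HodgeCMPerL package; no docstring in the source.) -/
theorem single_of_deg_one {m : Fock.HarmVar →₀ ℕ} (h1 : m (Sum.inl 0) + m (Sum.inl 1) = 1)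
    (h2 : m (Sum.inr ()) = 0) :
    m = Finsupp.single (Sum.inl 0) 1 ∨ m = Finsupp.single (Sum.inl 1) 1 := by
  rcases Nat.eq_zero_or_pos (m (Sum.inl 1)) with h | h
  · left
    ext v
    rcases v with a | u
    · fin_cases a <;> simp <;> omega
    · cases u; simp [h2]
  · right
    ext v
    rcases v with a | u
    · fin_cases a <;> simp <;> omega
    · cases u; simp [h2]

/-- **The lowest piece of `J⁺|_K` is `𝔭₊`**: `jplusDeg 1 = ℂz₁ ⊕ ℂz₂ = range zLin` (the image of the injective
`K`-intertwiner `zEmb : pPlus → Jplus`).  PerL ll. 646–648 at group level. -/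
theorem jplusDeg_one_eq_range_zLin : jplusDeg 1 = LinearMap.range zLin := by
  classical
  refine le_antisymm (fun f hf => ?_) ?_
  · rw [mem_jplusDeg_iff_support] at hf
    refine ⟨fun a => coeff (Finsupp.single (Sum.inl a) 1) f, ?_⟩
    apply MvPolynomial.ext
    intro m
    rw [zLin_apply, coeff_sum, Fin.sum_univ_two, coeff_smul, coeff_smul, coeff_X, coeff_X, smul_eq_mul,
      smul_eq_mul]
    by_cases h0 : Finsupp.single (Sum.inl (0 : Fin 2)) 1 = m
    · subst h0
      simp [Finsupp.single_eq_single_iff]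
    by_cases h1 : Finsupp.single (Sum.inl (1 : Fin 2)) 1 = m
    · subst h1
      simp [h0]
    rw [if_neg h0, if_neg h1, mul_zero, mul_zero, add_zero]
    symm
    by_contra hne
    obtain ⟨ha, hb⟩ := hf m (mem_support_iff.mpr hne)
    rcases single_of_deg_one ha (by omega) with rfl | rfl
    · exact h0 rfl
    · exact h1 rfl
  · rintro _ ⟨v, rfl⟩
    rw [mem_jplusDeg]
    refine ⟨mem_jplusSubmodule.mp (zLin_mem_jplus v), ?_⟩
    rw [zLin_apply]
    refine IsWeightedHomogeneous.sum _ _ _ (fun a _ => ?_)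
    rw [smul_eq_C_mul]
    exact (isWeightedHomogeneous_X ℂ zWt (Sum.inl a)).C_mul _

/-- The lowest piece is the image of `zEmb : 𝔭₊ ↪ J⁺|_K`, on the nose. -/
theorem jplusDeg_one_eq_map_zEmb :
    jplusDeg 1 = (LinearMap.range zEmb.toLinearMap).map jplusSubmodule.subtype := by
  rw [jplusDeg_one_eq_range_zLin, ← LinearMap.range_comp]
  rfl

/-! ## `𝔭₊` is irreducible: the lowest piece is ONE `K`-type (multiplicity one) -/

section PPlusIrreducible

open Complex

/-- (Ported verbatim from the HodgeCMPerL package; no docstring in the source.) -/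
theorem pPlus_t_apply (v : Fin 2 → ℂ) : pPlus t v = ![I * v 0, v 1] := by
  rw [pPlus_apply, mat_t]
  show star ((1 : unitary ℂ) : ℂ) • tM.mulVec v = _
  funext i
  fin_cases i <;> simp [tM, dotProduct, Fin.sum_univ_two]

/-- (Ported verbatim from the HodgeCMPerL package; no docstring in the source.) -/
theorem pPlus_r_apply (v : Fin 2 → ℂ) : pPlus r v = ![3 / 5 * v 0 + -(4 / 5) * v 1, 4 / 5 * v 0 + 3 / 5 * v 1] := by
  rw [pPlus_apply, mat_r]
  show star ((1 : unitary ℂ) : ℂ) • rM.mulVec v = _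
  funext i
  fin_cases i <;> simp [rM, dotProduct, Fin.sum_univ_two]
  all_goals ring

variable (S : Subrepresentation pPlus)

/-- (Ported verbatim from the HodgeCMPerL package; no docstring in the source.) -/
theorem pPlus_mem_of_smul_mem {a : ℂ} (ha : a ≠ 0) {v : Fin 2 → ℂ} (h : a • v ∈ S.toSubmodule) :
    v ∈ S.toSubmodule := by
  have := S.toSubmodule.smul_mem a⁻¹ h
  rwa [smul_smul, inv_mul_cancel₀ ha, one_smul] at this

/-- The torus element `t = (diag(i,1),1)` splits a vector of `S` into its two coordinates. -/
theorem pPlus_single_mem (v : Fin 2 → ℂ) (hv : v ∈ S.toSubmodule) (a : Fin 2) (ha : v a ≠ 0) :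
    (Pi.single a 1 : Fin 2 → ℂ) ∈ S.toSubmodule := by
  have ht : pPlus t v ∈ S.toSubmodule := S.apply_mem_toSubmodule t hv
  rw [pPlus_t_apply] at ht
  have hI1 : (I - 1 : ℂ) ≠ 0 := fun h => by simpa using congrArg Complex.re h
  fin_cases a
  · -- `t·v - v = (i-1) v₀ e₀`
    have h := S.toSubmodule.sub_mem ht hv
    refine pPlus_mem_of_smul_mem S (mul_ne_zero hI1 ha) ?_
    convert h using 1
    funext i
    fin_cases i <;> simp
    all_goals ring
  · -- `i v - t·v = (i-1) v₁ e₁`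
    have h := S.toSubmodule.sub_mem (S.toSubmodule.smul_mem I hv) ht
    refine pPlus_mem_of_smul_mem S (mul_ne_zero hI1 ha) ?_
    convert h using 1
    funext i
    fin_cases i <;> simp
    all_goals ring

/-- The rotation `r` moves `e₀` off the line `ℂe₀` and `e₁` off `ℂe₁`. -/
theorem pPlus_singles_mem (a : Fin 2) (ha : (Pi.single a 1 : Fin 2 → ℂ) ∈ S.toSubmodule) (b : Fin 2) :
    (Pi.single b 1 : Fin 2 → ℂ) ∈ S.toSubmodule := by
  have hr : pPlus r (Pi.single a 1) ∈ S.toSubmodule := S.apply_mem_toSubmodule r ha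
  rw [pPlus_r_apply] at hr
  refine pPlus_single_mem S _ hr b ?_
  fin_cases a <;> fin_cases b <;> simp

/-- (Ported verbatim from the HodgeCMPerL package; no docstring in the source.) -/
theorem pPlus_eq_top_of_ne_bot (hS : S ≠ ⊥) : S = ⊤ := by
  obtain ⟨v, hvS, hv0⟩ : ∃ v ∈ S.toSubmodule, v ≠ 0 := by
    by_contra hcon
    push Not at hcon
    apply hS
    apply Subrepresentation.toSubmodule_injective
    change S.toSubmodule = ⊥
    rw [Submodule.eq_bot_iff]
    exact hcon
  obtain ⟨a, ha⟩ : ∃ a, v a ≠ 0 := by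
    by_contra hcon
    push Not at hcon
    exact hv0 (funext hcon)
  have h0 := pPlus_singles_mem S a (pPlus_single_mem S v hvS a ha) 0
  have h1 := pPlus_singles_mem S a (pPlus_single_mem S v hvS a ha) 1
  apply Subrepresentation.toSubmodule_injective
  change S.toSubmodule = ⊤
  rw [Submodule.eq_top_iff']
  intro w
  have hw : w = w 0 • (Pi.single 0 1 : Fin 2 → ℂ) + w 1 • (Pi.single 1 1 : Fin 2 → ℂ) := by
    funext i
    fin_cases i <;> simp
  rw [hw]
  exact S.toSubmodule.add_mem (S.toSubmodule.smul_mem _ h0) (S.toSubmodule.smul_mem _ h1)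

end PPlusIrreducible

/-- **`𝔭₊` is an irreducible `K_{ι₁}`-module**; with `jplusDeg_one_eq_range_zLin` (and `zEmb` injective) the lowest
piece of `J⁺|_K` is the single `K`-type `𝔭₊`, with multiplicity one. -/
instance instPPlusIrreducible : pPlus.IsIrreducible where
  exists_pair_ne := ⟨⊥, ⊤, by
    intro h
    have h1 : (Pi.single 0 1 : Fin 2 → ℂ) ∈ (⊤ : Subrepresentation pPlus).toSubmodule := Submodule.mem_top
    rw [← h] at h1
    have := congrFun ((Submodule.mem_bot ℂ).mp h1) 0
    simp at this⟩
  eq_bot_or_eq_top S := by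
    by_cases hS : S = ⊥
    · exact Or.inl hS
    · exact Or.inr (pPlus_eq_top_of_ne_bot S hS)

/-- (Ported verbatim from the HodgeCMPerL package; no docstring in the source.) -/
theorem isSimpleModule_pPlus : IsSimpleModule (MonoidAlgebra ℂ K) pPlus.asModule := inferInstance

end P43KTypesU2
end PerL34
end HodgeCM

end
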